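import Summits.ResolutionOfSingularities.ResolutionOfSingularities.Theorems.ValuativeLuAlphaPTorsorLocAtCentreDerivations

/-!
# Transport of richness and of dual derivations along ring isomorphisms

Helper file for the line `pfaff-line-log-final-forms` of the crux `Valuative.LuAlphaPTorsor`
(item `stmt-ResolutionOfSingularities-0641`), stubs W1/W2 of the lead's skeleton.

The two facts about `ℤ`-derivations that Giraud's induction consumes — **richness** (every
`ψ`-derivation is, on a finite set, a finite combination of `ℤ`-derivations) and the existence
of **dual derivations** of a pair `v₀, v₁` generating the ideal of non-units — are invariant
under ring isomorphisms `e : R' ≃+* L` (for ARBITRARY `Algebra ℤ` structures on both sides).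
Both transports are the argument of `rich_locAtCentre` / `exists_dual_derivations_locAtCentre`
(`…LocAtCentreDerivations.lean`) for a general isomorphism, built on
`exists_derivation_transport_ringEquiv` (`D ↦ e ∘ D ∘ e⁻¹`).

* `rich_of_ringEquiv` (W1): richness of `Der_ℤ(L)` gives richness of `Der_ℤ(R')`;
* `duals_of_ringEquiv` (W2): dual derivations in `L` give dual derivations in `R'`.
-/

set_option linter.dupNamespace false

namespace Summit.ResolutionOfSingularities.ResolutionOfSingularities.Theorems.PfaffLine

/-- **W1, richness of `Der_ℤ` transports along ring isomorphisms.** If `e : R' ≃ L` is a ring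
isomorphism and every `ψ`-derivation `δ₀ : L → N` is, on each finite set, a finite combination
`δ₀ y = ∑_j ψ(Δ_j y) n_j` of `ℤ`-derivations `Δ_j` of `L`, then the same holds for `R'`: pull
`ψ, δ₀, Y` over to `L` along `e⁻¹`, apply richness there, and transport the `Δ_j` back along
`e⁻¹` (`exists_derivation_transport_ringEquiv`). [folklore] -/
theorem rich_of_ringEquiv : ∀ {R' L : Type} [CommRing R'] [CommRing L] [Algebra ℤ R'] [Algebra ℤ L] (e : R' ≃+* L), (∀ (N : Type) [CommRing N] (ψ : L →+* N) (δ₀ : L →+ N), (∀ a b, δ₀ (a * b) = ψ a * δ₀ b + ψ b * δ₀ a) → ∀ Y : Finset L, ∃ (m : ℕ) (Δ : Fin m → Derivation ℤ L L) (nn : Fin m → N), ∀ y ∈ Y, δ₀ y = Finset.univ.sum fun j => ψ (Δ j y) * nn j) → ∀ (N : Type) [CommRing N] (ψ : R' →+* N) (δ₀ : R' →+ N), (∀ a b, δ₀ (a * b) = ψ a * δ₀ b + ψ b * δ₀ a) → ∀ Y : Finset R', ∃ (m : ℕ) (Δ : Fin m → Derivation ℤ R' R') (nn : Fin m → N), ∀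 y ∈ Y, δ₀ y = Finset.univ.sum fun j => ψ (Δ j y) * nn j := by
  intro R' L _ _ _ _ e hrich N _ ψ δ₀ hleib Y
  classical
  -- pull the data over to `L` along `e⁻¹`
  have hleib' : ∀ a b, (δ₀.comp e.symm.toRingHom.toAddMonoidHom) (a * b) =
      (ψ.comp e.symm.toRingHom) a * (δ₀.comp e.symm.toRingHom.toAddMonoidHom) b +
        (ψ.comp e.symm.toRingHom) b * (δ₀.comp e.symm.toRingHom.toAddMonoidHom) a :=
    fun a b => by
    show δ₀ (e.symm (a * b)) = ψ (e.symm a) * δ₀ (e.symm b) + ψ (e.symm b) * δ₀ (e.symm a)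
    rw [map_mul]
    exact hleib _ _
  obtain ⟨m, Δ, nn, hΔ⟩ := hrich N (ψ.comp e.symm.toRingHom)
    (δ₀.comp e.symm.toRingHom.toAddMonoidHom) hleib' (Y.image e)
  -- transport the derivations back to `R'`
  choose Δ' hΔ' using fun j => exists_derivation_transport_ringEquiv e.symm (Δ j)
  refine ⟨m, Δ', nn, fun y hy => ?_⟩
  have H : δ₀ (e.symm (e y)) = Finset.univ.sum fun j => ψ (e.symm (Δ j (e y))) * nn j :=
    hΔ (e y) (Finset.mem_image_of_mem _ hy)
  rw [e.symm_apply_apply] at H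
  rw [H]
  refine Finset.sum_congr rfl fun j _ => ?_
  rw [← hΔ' j (e y), e.symm_apply_apply]

/-- **W2, dual derivations transport along ring isomorphisms.** If `e : R' ≃ L` is a ring
isomorphism and every pair `v₀, v₁ ∈ L` generating exactly the ideal of non-units admits dual
`ℤ`-derivations `D_l (v_j) = δ_lj`, then the same holds in `R'`: the pair `e ∘ v` generates the
non-units of `L` (ideals and units are preserved by `e`), and the dual derivations obtained in
`L` transport back along `e⁻¹` (`exists_derivation_transport_ringEquiv`). [folklore] -/
theorem duals_of_ringEquiv : ∀ {R' L : Type} [CommRing R'] [CommRing L] [Algebra ℤ R'] [Algebra ℤ L] (e : R' ≃+* L), (∀ v : Fin 2 → L, (∀ z : L, z ∈ Ideal.span (Set.range v) ↔ ¬ IsUnit z) → ∃ D : Fin 2 → Derivation ℤ L L, ∀ l j, D l (v j) = if l = j then 1 else 0) → ∀ v : Fin 2 → R', (∀ z : R', z ∈ Ideal.span (Set.range v) ↔ ¬ IsUnit z) → ∃ D : Fin 2 → Derivation ℤ R' R', ∀ l j, D l (v j) = if l = j then 1 else 0 := by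
  intro R' L _ _ _ _ e hdual v hv
  -- push the pair `v` forward to `L`: it still generates exactly the non-units
  have hv' : ∀ z : L, z ∈ Ideal.span (Set.range (⇑e ∘ v)) ↔ ¬ IsUnit z := fun z => by
    rw [Set.range_comp, ← Ideal.map_span, ← Ideal.symm_apply_mem_of_equiv_iff, hv (e.symm z),
      not_iff_not]
    constructor
    · intro hz
      rw [← e.apply_symm_apply z]
      exact hz.map e
    · intro hz
      exact hz.map e.symm
  obtain ⟨D, hD⟩ := hdual (⇑e ∘ v) hv'
  -- transport the derivations back to `R'`
  choose D' hD' using fun l => exists_derivation_transport_ringEquiv e.symm (D l)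
  refine ⟨D', fun l j => ?_⟩
  have H := hD' l (e (v j))
  rw [e.symm_apply_apply] at H
  rw [H, show D l (e (v j)) = if l = j then 1 else 0 from hD l j]
  split_ifs <;> simp

end Summit.ResolutionOfSingularities.ResolutionOfSingularities.Theorems.PfaffLine
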